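import Summits.ResolutionOfSingularities.ResolutionOfSingularities.Theses.UniversalCells
import Summits.ResolutionOfSingularities.ResolutionOfSingularities.Theorems.DescentDescentPerfectToAllRobustModel
import Literature.Barriers.ResolutionOfSingularities.InseparableBaseChangeResolution
import Literature.AlgebraicGeometry.Resolution.SmoothStalksRegular
import HarnessLib

/-!
# Crux `PrimeFieldToPerfect` (stmt-ResolutionOfSingularities-15233) — Negative lemma:
# `SmoothTwist` is FALSE without geometric integrality (all Frobenius levels at once)

Route `ResolutionOfSingularities/UniversalCells`, crux `PrimeFieldToPerfect`, kernel entry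
`SmoothTwist p` of the lead's skeleton (`Cruxes/PrimeFieldToPerfect/Lines/birth.lean`, RESHAPE 1/2;
landed supports `stub_limitDescent` p148751, `stub_spreadOut` p149455): "for `K` finitely generated
of characteristic `p` and `X₀ → Spec K` separated of finite type which is INTEGRAL OVER THE PERFECT
CLOSURE `K^{perf}`, some FINITE purely inseparable `K'/K` carries a proper birational
`π : Y → X₀ ×_K K'` with `Y → Spec K'` SMOOTH".

**This file (disprover, cycle 1): the hypothesis "integral over `K^{perf}`" cannot be weakened to
"`X₀` integral".** Witness, for every prime `p`: `K = 𝔽_p(t)`, `X₀ = Spec 𝔽_p(t^{1/p})` (a field: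
integral, regular, separated, of finite type over `K`; not geometrically reduced). For EVERY field
`K' ⊇ K` (finite or not, purely inseparable or not) and every proper birational `π : Y → X₀ ×_K K'`,
the structure map `Y → Spec K'` is NOT smooth (`no_smoothModel_inseparablePoint`): base-changing
along `K' → K̄'` would give a resolution of `X₀ ×_K K̄' ≅ Spec (𝔽_p(t^{1/p}) ⊗_K K̄')`, a one-point
non-reduced scheme (`t^{1/p} ⊗ 1 − 1 ⊗ t^{1/p}` is nilpotent and non-zero), which has none. Hence
the displayed weakening of `SmoothTwist p` is false for every `p`
(`smoothTwist_false_without_geomIntegral`): no amount of Frobenius twisting repairs geometric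
non-reducedness, so any proof of the kernel must use integrality over `K^{perf}` (equivalently
geometric reducedness of `X₀`), not merely integrality of `X₀` — the reduction to that case is the
landed `stub_limitDescent`/`descentReducedToIntegral_proof`, where it belongs.

Relation to the catalogue: `Literature.Barriers.ResolutionOfSingularities.FrobeniusTwistResolution`
treats the single twist `Spec k[x]/((x − t)^p)` and records the all-level / arbitrary-`K'` scheme
statement as NOT formalised (scope caveat (b)); `InseparableBaseChangeResolution` is the level-0 case
`K' = K(t^{1/p})`. New here: arbitrary field `K' ⊇ K`, and SMOOTH models (not resolutions of the
twist) are excluded, in the exact shape of the registered stub signature.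
-/

noncomputable section

-- single-problem summit: the doubled namespace component `ResolutionOfSingularities` is forced
set_option linter.dupNamespace false

open CategoryTheory CategoryTheory.Limits AlgebraicGeometry TensorProduct
open Literature.AlgebraicGeometry.Resolution Literature.Barriers.ResolutionOfSingularities

namespace Summit.ResolutionOfSingularities.ResolutionOfSingularities.Theorems.PrimeFieldToPerfect.Negative

/-! ## §1 Algebra: `K(t^{1/p}) ⊗_K F` is one non-reduced point whenever `t` is a `p`-th power in `F` -/

section Algebra

variable {k E F : Type*} [Field k] [Field E] [Field F] [Algebra k E] [Algebra k F]

/-- Separation of `s ⊗ 1` from `1 ⊗ F` by a `k`-linear functional: if `s ∈ E` is not in `k`, then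
`s ⊗ 1 ≠ 1 ⊗ s'` in `E ⊗ₖ F` for every `s' ∈ F`, and `s ⊗ 1 ≠ 0`. [folklore] -/
theorem tmul_one_ne_one_tmul_of_not_mem_range (s : E) (hs : s ∉ Set.range (algebraMap k E))
    (s' : F) : (s ⊗ₜ[k] (1 : F)) ≠ ((1 : E) ⊗ₜ[k] s') ∧ (s ⊗ₜ[k] (1 : F)) ≠ 0 := by
  -- a functional on `E` killing `1` but not `s`
  have hs1 : s ∉ Submodule.span k {(1 : E)} := by
    intro h
    obtain ⟨a, ha⟩ := Submodule.mem_span_singleton.mp h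
    exact hs ⟨a, by rw [Algebra.algebraMap_eq_smul_one, ha]⟩
  obtain ⟨φ, hφs, hφ1⟩ :=
    Submodule.exists_dual_map_eq_bot_of_notMem hs1 Module.Projective.of_free
  have hφone : φ 1 = 0 := by
    have : φ 1 ∈ Submodule.map φ (Submodule.span k {(1 : E)}) :=
      Submodule.mem_map_of_mem (Submodule.mem_span_singleton_self _)
    rw [hφ1] at this
    simpa using this
  -- a functional on `F` not killing `1`
  obtain ⟨χ, hχ⟩ := Module.Projective.exists_dual_ne_zero k (x := (1 : F)) one_ne_zero
  let Λ : E ⊗[k] F →ₗ[k] k := (TensorProduct.lid k k).toLinearMap ∘ₗ TensorProduct.map φ χ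
  have hΛ1 : Λ (s ⊗ₜ[k] (1 : F)) = φ s * χ 1 := by
    simp [Λ]
  have hΛ2 : Λ ((1 : E) ⊗ₜ[k] s') = 0 := by
    simp [Λ, hφone]
  refine ⟨fun h => ?_, fun h => ?_⟩
  · have := congrArg Λ h
    rw [hΛ1, hΛ2] at this
    exact mul_ne_zero hφs hχ this
  · have := congrArg Λ h
    rw [hΛ1, map_zero] at this
    exact mul_ne_zero hφs hχ this

variable (p : ℕ) [hp : Fact p.Prime]

/-- Frobenius on `E ⊗ₖ F` when `E^p ⊆ k`: every `p`-th power lies in `1 ⊗ F`. [folklore] -/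
theorem pow_char_mem_one_tmul [CharP (E ⊗[k] F) p]
    (hE : ∀ b : E, b ^ p ∈ Set.range (algebraMap k E)) (z : E ⊗[k] F) :
    ∃ c : F, z ^ p = (1 : E) ⊗ₜ[k] c := by
  induction z using TensorProduct.induction_on with
  | zero => exact ⟨0, by simp [zero_pow hp.out.ne_zero]⟩
  | tmul a b =>
      obtain ⟨d, hd⟩ := hE a
      refine ⟨d • b ^ p, ?_⟩
      rw [Algebra.TensorProduct.tmul_pow, ← hd, Algebra.algebraMap_eq_smul_one,
        TensorProduct.smul_tmul]
  | add x y hx hy =>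
      obtain ⟨c, hc⟩ := hx
      obtain ⟨d, hd⟩ := hy
      exact ⟨c + d, by rw [add_pow_char, hc, hd, TensorProduct.tmul_add]⟩

/-- When `E^p ⊆ k`, every element of `E ⊗ₖ F` is a unit or nilpotent (one point, nil maximal
ideal). [cite: Liu2002, Example 3.2.12 and Prop. 3.2.7] -/
theorem isUnit_or_isNilpotent_tensor [CharP (E ⊗[k] F) p]
    (hE : ∀ b : E, b ^ p ∈ Set.range (algebraMap k E)) (z : E ⊗[k] F) :
    IsUnit z ∨ IsNilpotent z := by
  obtain ⟨c, hc⟩ := pow_char_mem_one_tmul p hE z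
  by_cases h0 : c = 0
  · right
    exact ⟨p, by rw [hc, h0, TensorProduct.tmul_zero]⟩
  · left
    have hu : IsUnit ((1 : E) ⊗ₜ[k] c) := by
      have := (isUnit_iff_ne_zero.mpr h0).map
        (Algebra.TensorProduct.includeRight : F →ₐ[k] E ⊗[k] F)
      simpa [Algebra.TensorProduct.includeRight_apply] using this
    rw [← hc] at hu
    exact (isUnit_pow_iff hp.out.ne_zero).mp hu

/-- The mechanism at an arbitrary level: if `s ∈ E ∖ k` and `s' ∈ F` have the SAME `p`-th power
`t ∈ k`, then `E ⊗ₖ F` is not reduced (`(s ⊗ 1 − 1 ⊗ s')^p = t ⊗ 1 − 1 ⊗ t = 0`, `s ⊗ 1 ≠ 1 ⊗ s'`).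
[cite: Liu2002, Example 3.2.12] -/
theorem not_isReduced_tensor_of_pthRoots [CharP E p] (s : E) (hs : s ∉ Set.range (algebraMap k E))
    (t : k) (hst : s ^ p = algebraMap k E t) (s' : F) (hs't : s' ^ p = algebraMap k F t) :
    ¬ _root_.IsReduced (E ⊗[k] F) := by
  intro hred
  obtain ⟨hne, hne0⟩ := tmul_one_ne_one_tmul_of_not_mem_range (k := k) s hs s'
  haveI : Nontrivial (E ⊗[k] F) := ⟨⟨_, 0, hne0⟩⟩
  haveI : CharP (E ⊗[k] F) p :=
    charP_of_injective_algebraMap (algebraMap E (E ⊗[k] F)).injective p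
  set x : E ⊗[k] F := s ⊗ₜ[k] 1 - 1 ⊗ₜ[k] s' with hx
  have hxp : x ^ p = 0 := by
    rw [hx, sub_pow_char, Algebra.TensorProduct.tmul_pow, Algebra.TensorProduct.tmul_pow, one_pow,
      one_pow, hst, hs't, Algebra.algebraMap_eq_smul_one, Algebra.algebraMap_eq_smul_one,
      TensorProduct.smul_tmul, sub_self]
  exact hne (sub_eq_zero.mp (hred.eq_zero x ⟨p, hxp⟩))

end Algebra

/-! ## §2 The inseparable point `X₀ = Spec 𝔽_p(t^{1/p})` over `K = 𝔽_p(t)` at an arbitrary level `F ⊇ K` -/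

section Point

variable (p : ℕ) [hp : Fact p.Prime]

/-- `𝔽_p(t)` is finitely generated as a field (by `t`): the hypothesis `FieldFG K` of the kernel
holds for the witness field. [folklore] -/
theorem subfield_closure_ratFuncX :
    ∃ s : Finset (baseField p), Subfield.closure (s : Set (baseField p)) = ⊤ := by
  classical
  refine ⟨{RatFunc.X}, ?_⟩
  rw [Finset.coe_singleton, eq_top_iff]
  rintro f -
  set S : Subfield (baseField p) := Subfield.closure {RatFunc.X} with hS
  have hX : (RatFunc.X : baseField p) ∈ S := Subfield.subset_closure rfl
  -- polynomials in `t` lie in `S`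
  have hpoly : ∀ q : Polynomial (ZMod p), algebraMap (Polynomial (ZMod p)) (baseField p) q ∈ S := by
    intro q
    induction q using Polynomial.induction_on with
    | C a =>
        rw [RatFunc.algebraMap_C]
        have : (RatFunc.C a : baseField p) = ((a.val : ℕ) : baseField p) :=
          calc (RatFunc.C a : baseField p) = RatFunc.C ((a.val : ℕ) : ZMod p) := by
                rw [ZMod.natCast_zmod_val]
            _ = ((a.val : ℕ) : baseField p) := map_natCast _ _
        rw [this]
        exact natCast_mem S a.val
    | add q r hq hr => rw [map_add]; exact add_mem hq hr
    | monomial n a h =>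
        rw [pow_succ, ← mul_assoc, map_mul, RatFunc.algebraMap_X]
        exact mul_mem h hX
  rw [← RatFunc.num_div_denom f]
  exact div_mem (hpoly _) (hpoly _)

/-- **Smooth models base-change to resolutions at every further level.** For `f₀ : X₀ → Spec K`
of finite type, a field `F ⊇ K`, and a proper birational `π : Y → X₀ ×_K F` with `Y → Spec F`
SMOOTH, every further field `F' ⊇ F` yields a resolution of `X₀ ×_K F'`: the base change of `π`
along the flat `Spec F' → Spec F` is proper and birational (Noetherian schemes) and its source is
smooth over `F'`, hence regular (Stacks 056S). This is the (true) mechanism by which `SmoothTwist`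
feeds `stub_limitDescent`; it is used NEGATIVELY below. [cite: StacksProject, Tag 056S (Lemma 33.25.3)] -/
theorem hasResolution_level_of_smoothModel {K : Type} [Field K] {X₀ : Scheme.{0}}
    (f₀ : X₀ ⟶ Spec (.of K)) [LocallyOfFiniteType f₀] [QuasiCompact f₀]
    (F : Type) [Field F] [Algebra K F] (Y : Scheme.{0})
    (π : Y ⟶ pullback f₀ (Spec.map (CommRingCat.ofHom (algebraMap K F)))) [IsProper π]
    (hbir : IsBirational π)
    [Smooth (π ≫ pullback.snd f₀ (Spec.map (CommRingCat.ofHom (algebraMap K F))))]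
    (F' : Type) [Field F'] [Algebra K F'] [Algebra F F'] [IsScalarTower K F F'] :
    Scheme.HasResolution (pullback f₀ (Spec.map (CommRingCat.ofHom (algebraMap K F')))) := by
  -- `Spec F' → Spec F` is flat
  haveI : Flat (Spec.map (CommRingCat.ofHom (algebraMap F F'))) :=
    HasRingHomProperty.Spec_iff.mpr (RingHom.Flat.of_isField (Field.toIsField F) _)
  -- Noetherian: everything is of finite type over the field `F`
  haveI : AlgebraicGeometry.IsNoetherian (pullback f₀ (Spec.map (CommRingCat.ofHom (algebraMap K F)))) :=
    Scheme.isNoetherian_of_finiteType_over_field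
      (pullback.snd f₀ (Spec.map (CommRingCat.ofHom (algebraMap K F))))
  haveI : AlgebraicGeometry.IsNoetherian Y :=
    Scheme.isNoetherian_of_finiteType_over_field
      (π ≫ pullback.snd f₀ (Spec.map (CommRingCat.ofHom (algebraMap K F))))
  -- the base change of `Y` to `F'` is smooth over `F'`, hence regular
  have hreg : Scheme.IsRegular
      (pullback (π ≫ pullback.snd f₀ (Spec.map (CommRingCat.ofHom (algebraMap K F))))
        (Spec.map (CommRingCat.ofHom (algebraMap F F')))) := fun y =>
    isRegularLocalRing_stalk_of_smooth_of_field
      (pullback.snd (π ≫ pullback.snd f₀ (Spec.map (CommRingCat.ofHom (algebraMap K F))))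
        (Spec.map (CommRingCat.ofHom (algebraMap F F')))) y
  -- so `(X₀ ×_K F) ×_F F'` has a resolution
  have hres := Summit.ResolutionOfSingularities.ResolutionOfSingularities.Theorems.hasResolution_pullback_snd_of_flat
    f₀ (Spec.map (CommRingCat.ofHom (algebraMap K F))) (Spec.map (CommRingCat.ofHom (algebraMap F F')))
    π hbir hreg
  -- transport along `(X₀ ×_K F) ×_F F' ≅ X₀ ×_K F'`
  have e : Spec.map (CommRingCat.ofHom (algebraMap F F')) ≫
      Spec.map (CommRingCat.ofHom (algebraMap K F)) =
        Spec.map (CommRingCat.ofHom (algebraMap K F')) := by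
    rw [← Spec.map_comp, ← CommRingCat.ofHom_comp, ← IsScalarTower.algebraMap_eq]
  exact hres.of_iso
    (pullbackLeftPullbackSndIso f₀ (Spec.map (CommRingCat.ofHom (algebraMap K F)))
        (Spec.map (CommRingCat.ofHom (algebraMap F F'))) ≪≫ pullback.congrHom rfl e).hom

/-- **No Frobenius level repairs the inseparable point.** For `K = 𝔽_p(t)`, `X₀ = Spec K(t^{1/p})`
and ANY field `F` over `K`: no proper birational `π : Y → X₀ ×_K F` has `Y` smooth over `F`.
Proof: by `hasResolution_level_of_smoothModel` with `F' = F̄`, `X₀ ×_K F̄ ≅ Spec (K(t^{1/p}) ⊗_K F̄)`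
would have a resolution; it is one NON-REDUCED point (`t^{1/p} ⊗ 1 − 1 ⊗ t^{1/p}` nilpotent,
non-zero), contradiction. [cite: Liu2002, Example 3.2.12 and Remark 4.3.34] -/
theorem no_smoothModel_inseparablePoint (F : Type) [Field F] [Algebra (baseField p) F]
    (Y : Scheme.{0})
    (π : Y ⟶ pullback (Spec.map (CommRingCat.ofHom (algebraMap (baseField p) (extField p))))
      (Spec.map (CommRingCat.ofHom (algebraMap (baseField p) F))))
    [IsProper π] (hbir : IsBirational π)
    [Smooth (π ≫ pullback.snd (Spec.map (CommRingCat.ofHom (algebraMap (baseField p) (extField p))))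
      (Spec.map (CommRingCat.ofHom (algebraMap (baseField p) F))))] :
    False := by
  haveI : LocallyOfFiniteType
      (Spec.map (CommRingCat.ofHom (algebraMap (baseField p) (extField p)))) :=
    locallyOfFiniteType_Spec_extField p
  let Fbar : Type := AlgebraicClosure F
  -- a resolution of `X₀ ×_K F̄ ≅ Spec (K(t^{1/p}) ⊗_K F̄)`
  have hres : Scheme.HasResolution (Spec (.of (extField p ⊗[baseField p] Fbar))) :=
    (hasResolution_level_of_smoothModel
      (Spec.map (CommRingCat.ofHom (algebraMap (baseField p) (extField p)))) F Y π hbir Fbar).of_iso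
      (pullbackSpecIso (baseField p) (extField p) Fbar).hom
  -- but that is one non-reduced point
  obtain ⟨σ, hσ⟩ := IsAlgClosed.exists_pow_nat_eq
    (algebraMap (baseField p) Fbar RatFunc.X) hp.out.pos
  have hred : ¬ _root_.IsReduced (extField p ⊗[baseField p] Fbar) :=
    not_isReduced_tensor_of_pthRoots p (AdjoinRoot.root (insepPoly p)) (root_not_mem_range p)
      RatFunc.X (root_pow_eq p) σ hσ
  obtain ⟨-, hne0⟩ := tmul_one_ne_one_tmul_of_not_mem_range (k := baseField p) (F := Fbar)
    (AdjoinRoot.root (insepPoly p)) (root_not_mem_range p) σ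
  haveI : Nontrivial (extField p ⊗[baseField p] Fbar) := ⟨⟨_, 0, hne0⟩⟩
  haveI : CharP (extField p ⊗[baseField p] Fbar) p :=
    charP_of_injective_algebraMap
      (algebraMap (extField p) (extField p ⊗[baseField p] Fbar)).injective p
  exact not_hasResolution_Spec_of_isUnit_or_isNilpotent
    (isUnit_or_isNilpotent_tensor p (pow_mem_range_extField p)) hred hres

/-- **`SmoothTwist` without geometric integrality is FALSE (every prime `p`).** The registered
kernel signature `stub_smoothTwist` / `SmoothTwist p` of crux `PrimeFieldToPerfect` with its
hypothesis "`X₀ ×_K L` integral for some perfect purely inseparable `L/K`" weakened to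
"`X₀` integral": refuted by `K = 𝔽_p(t)`, `X₀ = Spec 𝔽_p(t^{1/p})`
(`no_smoothModel_inseparablePoint`). So the geometric hypothesis of the kernel is load-bearing: no
finite purely inseparable level `K'` makes a smooth proper birational model appear unless `X₀` is
geometrically reduced. [cite: Liu2002, Example 3.2.12 and Remark 4.3.34] -/
theorem smoothTwist_false_without_geomIntegral :
    ¬ ∀ (K : Type) [Field K] [CharP K p], (∃ s : Finset K, Subfield.closure (s : Set K) = ⊤) →
      ∀ (X₀ : Scheme.{0}) (f₀ : X₀ ⟶ Spec (.of K)),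
        IsSeparated f₀ → LocallyOfFiniteType f₀ → QuasiCompact f₀ → IsIntegral X₀ →
        ∃ (K' : Type) (_ : Field K') (_ : Algebra K K') (_ : IsPurelyInseparable K K')
          (_ : Module.Finite K K') (Y : Scheme.{0})
          (π : Y ⟶ pullback f₀ (Spec.map (CommRingCat.ofHom (algebraMap K K')))),
          IsProper π ∧ IsBirational π ∧
            Smooth (π ≫ pullback.snd f₀ (Spec.map (CommRingCat.ofHom (algebraMap K K')))) := by
  intro h
  obtain ⟨K', _, _, _, _, Y, π, hP, hB, hS⟩ :=
    h (baseField p) (subfield_closure_ratFuncX p) (Spec (.of (extField p)))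
      (Spec.map (CommRingCat.ofHom (algebraMap (baseField p) (extField p)))) inferInstance
      (locallyOfFiniteType_Spec_extField p) inferInstance inferInstance
  exact no_smoothModel_inseparablePoint p K' Y π hB

end Point

/-- The same for all primes at once, in the `∀ p, p.Prime → …` shape of the skeleton's
`Sig.stub_smoothTwist` with the resolution hypotheses dropped as irrelevant: the weakened kernel
fails already at `p = 2`. [cite: Liu2002, Example 3.2.12] -/
theorem smoothTwist_false_without_geomIntegral_all :
    ¬ ∀ p : ℕ, p.Prime → ∀ (K : Type) [Field K] [CharP K p],
      (∃ s : Finset K, Subfield.closure (s : Set K) = ⊤) →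
      ∀ (X₀ : Scheme.{0}) (f₀ : X₀ ⟶ Spec (.of K)),
        IsSeparated f₀ → LocallyOfFiniteType f₀ → QuasiCompact f₀ → IsIntegral X₀ →
        ∃ (K' : Type) (_ : Field K') (_ : Algebra K K') (_ : IsPurelyInseparable K K')
          (_ : Module.Finite K K') (Y : Scheme.{0})
          (π : Y ⟶ pullback f₀ (Spec.map (CommRingCat.ofHom (algebraMap K K')))),
          IsProper π ∧ IsBirational π ∧
            Smooth (π ≫ pullback.snd f₀ (Spec.map (CommRingCat.ofHom (algebraMap K K')))) := by
  intro h
  haveI : Fact (Nat.Prime 2) := ⟨Nat.prime_two⟩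
  exact smoothTwist_false_without_geomIntegral 2 (fun K _ _ hK X₀ f₀ hs hl hq hi => h 2 Nat.prime_two K hK X₀ f₀ hs hl hq hi)

end Summit.ResolutionOfSingularities.ResolutionOfSingularities.Theorems.PrimeFieldToPerfect.Negative

end
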